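import Literature.Computability.AlgebraicComplexity.BDI20BoundedDegreeSatGraph
import Literature.Computability.AlgebraicComplexity.BDI20HwvSubexpDeciderSE
import Literature.Computability.Complexity.KSATReductions
import Literature.Computability.Complexity.OracleProofs
import Literature.Computability.FineGrained.SerfSNPEthProofs
import HarnessLib

/-!
# Bläser–Dörfler–Ikenmeyer 2020/21, Thm 8.1 (arXiv Thm 22), ETH clause — discharge of
# `BDI2020_thm_8_1_eth`: under ETH no `2^{o(n)}` algorithm decides `f_T̂(p_d) ≠ 0`

Theorem-only companion of `BDI20HwvEvaluationHardness.lean` (cell `val-lit`, seat x6), third of three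
files: **`BDI2020_thm_8_1_eth_holds : BDI2020_thm_8_1_eth`**. No new named fact, no `instance`, no
`notation`; the `def`s are bodied plumbing (encoders, the Karp map). HONEST FRAMING: a published 2021
conditional lower bound ("assuming ETH") kernel-checked over the tree's fine-grained framework
(Impagliazzo–Paturi–Zane `SE`/SERF, the PROVED sparsification lemma); ETH itself is an open
hypothesis and stays one; nothing here bears on `VP ≠ VNP`, which is NOT proved.

## The proof (printed: "Assuming ETH no `2^{o(n)}` algorithm for this evaluation can exist", one line
after the NP-hardness reduction of Thm 22; the folklore transfer made explicit)

* ETH ⟺ `3`-SAT with parameter `m` (number of clauses) is not in `SE`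
  (`eth_iff_kSATClauseParam_not_mem_SE_holds`, Impagliazzo–Paturi–Zane 2001 Cor. 2, over the tree's
  PROVED sparsification lemma).
* §1–§3 (this file): the instance map `x ↦ T̂_{G_φ}` — CNF code `x` of `φ` ↦ the BDI tableau
  (`BDI20NPHard.graphTableau`) of the linear-size maximum-degree-`4` graph `BDI20SatGraph.cnfAdj φ` of
  `BDI20BoundedDegreeSatGraph.lean` (the empty CNF ↦ the yes-instance `[]`; non-codes, CNFs with an
  empty or a wide clause ↦ the no-instance `[[0],[0,0]]`) — is computed on codes by a polynomial-time
  string function (typed `CodeFP` algebra, exactly as the NP-hardness file does for graph codes), and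
  `x ∈ 3SAT ⟺ T̂ ∈ nonvanishingSet₃ d M` (`d ≥ 8`, `M ≥ 2`), with `numLabels T̂ - 1 ≤ 40 m`.
* §4: hence `3`-SAT with parameter `m` SERF-reduces (one query; Ladner–Lynch–Selman packaging
  `karpAlg`/`karpLift` as in `SerfSNPProofs.lean`) to the tableau problem with parameter
  `numLabels - 1` (`BDI2020.subexpParam (nonvanishingSet₃ d M) id`).
* §5: a `2^{o(n)}` decider (`BDI2020.HasSubexpDecider _ id`) would put that problem in `SE`
  (`BDI2020.subexpParam_mem_SE`, `BDI20HwvSubexpDeciderSE.lean`), hence `3`-SAT with parameter `m`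
  in `SE` (`mem_SE_of_serfReducible_holds`), contradicting ETH.

## References
* [BlaserDorflerIkenmeyer2020] M. Bläser, J. Dörfler, C. Ikenmeyer, *On the complexity of evaluating
  highest weight vectors*, arXiv:2002.11594, Thm 22 (p.17: "Assuming ETH no `2^{o(n)}` algorithm for
  this evaluation can exist.") = CCC 2021, LIPIcs 200:29, Thm 8.1.
* [ImpagliazzoPaturiZaneJCSS2001] R. Impagliazzo, R. Paturi, F. Zane, *Which problems have strongly
  exponential complexity?*, JCSS 63 (2001), §2 (SE, SERF, Cor. 2).
* [GareyJohnsonStockmeyer1976] M. R. Garey, D. S. Johnson, L. J. Stockmeyer, *Some simplified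
  NP-complete graph problems*, TCS 1 (1976), Thm 2.1, §2.
* [LadnerLynchSelman1975] R. E. Ladner, N. A. Lynch, A. L. Selman, *A comparison of polynomial time
  reducibilities*, TCS 1 (1975), p. 104 and Prop. 2.1 (a many-one reduction is a one-query Turing
  reduction).
* [AroraBarak2009] S. Arora, B. Barak, *Computational Complexity: A Modern Approach*, CUP 2009, §0.1,
  §1.3, Def. 2.7.
-/

noncomputable section

open _root_.Computability

namespace Literature.Computability.AlgebraicComplexity

namespace BDI20ETH

open Literature.Computability.Complexity Literature.Computability.Cryptography
open Literature.Computability.FineGrained (kSATClauseParam kSATClauseParam_lang kSATClauseParam_param_encode)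
open CodeFP Brick BDI2020 BDI20NPHard BDI20SatGraph

/-! ### §1. Encoders -/

/-- Code of a literal. [cite: AroraBarak2009, §0.1] -/
abbrev litE : Literal ℕ → List Bool := pairE natE bitE
/-- Code of a clause. [cite: AroraBarak2009, §0.1] -/
abbrev clauseE : Clause ℕ → List Bool := listE litE
/-- Code of a CNF (`encodingCNF`). [cite: AroraBarak2009, §0.1] -/
abbrev cnfE : CNF ℕ → List Bool := listE clauseE

/-- `cnfE` is `encodingCNF.encode`. [cite: AroraBarak2009, §0.1 (codes of lists)] -/
theorem cnfE_eq : (encodingCNF.encode : CNF ℕ → List Bool) = cnfE := by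
  unfold cnfE clauseE litE encodingCNF encodingClause encodingLiteral
  rw [listE_eq, listE_eq, pairE_eq, natE_eq, bitE_eq]

/-- The clause list in raw format. [cite: AroraBarak2009, §1.3] -/
theorem clausesFP : CodeFP cnfE (rawE (rawE litE)) (fun φ : CNF ℕ => φ) :=
  ((map₀ (rawOfList litE)).comp (rawOfList clauseE)).congr fun φ => by simp

/-- The number of clauses on codes (binary). [cite: AroraBarak2009, §1.3] -/
theorem lengthFP : CodeFP cnfE natE (fun φ : CNF ℕ => φ.length) :=
  ((natLength clauseE).comp (rawOfList clauseE)).congr fun _ => rfl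

/-- The number of clauses on codes (unary). [cite: AroraBarak2009, §1.3] -/
theorem ulengthFP : CodeFP cnfE unE (fun φ : CNF ℕ => φ.length) :=
  ((ulength clauseE).comp (rawOfList clauseE)).congr fun _ => rfl

/-! ### §2. Label arithmetic and the edge test on codes -/

section LabelFP

variable {σ : Type} {eσ : σ → List Bool} {mf ef : σ → ℕ}

/-- `9 + c·m` on codes. [cite: AroraBarak2009, §1.3] -/
theorem affFP (c₀ c₁ : ℕ) (hm : CodeFP eσ natE mf) : CodeFP eσ natE (fun s => c₀ + c₁ * mf s) :=
  (natAdd.comp ((const _ c₀).pair (natMul.comp ((const _ c₁).pair hm)))).congr fun _ => rfl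

/-- `isSlot` on codes. [cite: AroraBarak2009, §1.3] -/
theorem isSlotFP (hm : CodeFP eσ natE mf) (he : CodeFP eσ natE ef) :
    CodeFP eσ bitE (fun s => isSlot (mf s) (ef s)) :=
  ((natLe.comp ((const _ 1).pair he)).and (natLt.comp (he.pair (affFP 9 20 hm)))).congr fun _ => rfl

/-- `isUnit` on codes. [cite: AroraBarak2009, §1.3] -/
theorem isUnitFP (hm : CodeFP eσ natE mf) (he : CodeFP eσ natE ef) :
    CodeFP eσ bitE (fun s => isUnit (mf s) (ef s)) :=
  ((natLe.comp ((affFP 9 20 hm).pair he)).and (natLt.comp (he.pair (affFP 9 26 hm)))).congr fun _ => rfl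

/-- `isGad` on codes. [cite: AroraBarak2009, §1.3] -/
theorem isGadFP (hm : CodeFP eσ natE mf) (he : CodeFP eσ natE ef) :
    CodeFP eσ bitE (fun s => isGad (mf s) (ef s)) :=
  ((natLe.comp ((affFP 9 26 hm).pair he)).and (natLt.comp (he.pair (affFP 9 32 hm)))).congr fun _ => rfl

/-- `sk` on codes. [cite: AroraBarak2009, §1.3] -/
theorem skFP (he : CodeFP eσ natE ef) : CodeFP eσ natE (fun s => sk (ef s)) :=
  (natDiv.comp ((natSub.comp (he.pair (const _ 1))).pair (const _ 4))).congr fun _ => rfl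

/-- `st` on codes. [cite: AroraBarak2009, §1.3] -/
theorem stFP (he : CodeFP eσ natE ef) : CodeFP eσ natE (fun s => st (ef s)) :=
  (natMod.comp ((natSub.comp (he.pair (const _ 1))).pair (const _ 4))).congr fun _ => rfl

/-- `ur` on codes. [cite: AroraBarak2009, §1.3] -/
theorem urFP (hm : CodeFP eσ natE mf) (he : CodeFP eσ natE ef) : CodeFP eσ natE (fun s => ur (mf s) (ef s)) :=
  (natDiv.comp ((natSub.comp (he.pair (affFP 9 20 hm))).pair (const _ 2))).congr fun _ => rfl

/-- `us` on codes. [cite: AroraBarak2009, §1.3] -/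
theorem usFP (hm : CodeFP eσ natE mf) (he : CodeFP eσ natE ef) : CodeFP eσ natE (fun s => us (mf s) (ef s)) :=
  (natMod.comp ((natSub.comp (he.pair (affFP 9 20 hm))).pair (const _ 2))).congr fun _ => rfl

/-- `gj` on codes. [cite: AroraBarak2009, §1.3] -/
theorem gjFP (hm : CodeFP eσ natE mf) (he : CodeFP eσ natE ef) : CodeFP eσ natE (fun s => gj (mf s) (ef s)) :=
  (natDiv.comp ((natSub.comp (he.pair (affFP 9 26 hm))).pair (const _ 6))).congr fun _ => rfl

/-- `gt` on codes. [cite: AroraBarak2009, §1.3] -/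
theorem gtFP (hm : CodeFP eσ natE mf) (he : CodeFP eσ natE ef) : CodeFP eσ natE (fun s => gt (mf s) (ef s)) :=
  (natMod.comp ((natSub.comp (he.pair (affFP 9 26 hm))).pair (const _ 6))).congr fun _ => rfl

/-- `decide (f = g)` on codes. [cite: AroraBarak2009, §1.3] -/
theorem eqFP {f g : σ → ℕ} (hf : CodeFP eσ natE f) (hg : CodeFP eσ natE g) :
    CodeFP eσ bitE (fun s => decide (f s = g s)) := (natEq.comp (hf.pair hg)).congr fun _ => rfl

/-- `decide (f = k)` on codes. [cite: AroraBarak2009, §1.3] -/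
theorem eqcFP {f : σ → ℕ} (k : ℕ) (hf : CodeFP eσ natE f) : CodeFP eσ bitE (fun s => decide (f s = k)) :=
  (natEq.comp (hf.pair (const _ k))).congr fun _ => rfl

/-- `decide (f < g)` on codes. [cite: AroraBarak2009, §1.3] -/
theorem ltFP {f g : σ → ℕ} (hf : CodeFP eσ natE f) (hg : CodeFP eσ natE g) :
    CodeFP eσ bitE (fun s => decide (f s < g s)) := (natLt.comp (hf.pair hg)).congr fun _ => rfl

/-- `f + k` on codes. [cite: AroraBarak2009, §1.3] -/
theorem addcFP {f : σ → ℕ} (k : ℕ) (hf : CodeFP eσ natE f) : CodeFP eσ natE (fun s => f s + k) :=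
  (natAdd.comp (hf.pair (const _ k))).congr fun _ => rfl

end LabelFP

/-- **The literal of an occurrence on codes** (`litOf`, by `rawGetOr`). [cite: AroraBarak2009, §1.3] -/
theorem litOfFP : CodeFP (pairE cnfE natE) litE (fun q => litOf q.1 q.2) := by
  have hφ : CodeFP (pairE cnfE natE) (rawE (rawE litE)) (fun q => q.1) := clausesFP.comp (fst _ _)
  have hr : CodeFP (pairE cnfE natE) natE (fun q => q.2) := snd _ _
  have hj : CodeFP (pairE cnfE natE) natE (fun q => q.2 / 3) := (natDiv.comp (hr.pair (const _ 3))).congr fun _ => rfl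
  have hp : CodeFP (pairE cnfE natE) natE (fun q => q.2 % 3) := (natMod.comp (hr.pair (const _ 3))).congr fun _ => rfl
  have hcl : CodeFP (pairE cnfE natE) (rawE litE) (fun q => q.1.getD (q.2 / 3) []) :=
    ((rawGetD (rawE litE) (rawE_nil litE)).comp (hφ.pair hj)).congr fun _ => rfl
  have hlen : CodeFP (pairE cnfE natE) natE (fun q => (q.1.getD (q.2 / 3) []).length) := (natLength litE).comp hcl
  have hidx : CodeFP (pairE cnfE natE) natE
      (fun q => if q.2 % 3 < (q.1.getD (q.2 / 3) []).length then q.2 % 3 else 0) :=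
    ((ltFP hp hlen).ite hp (const _ 0)).congr fun _ => by simp only [decide_eq_true_eq]
  exact ((rawGetOr litE).comp (hcl.pair (hidx.pair (const _ (((0 : ℕ), false) : Literal ℕ))))).congr
    fun q => by unfold litOf; rfl

/-- `varOf` on codes. [cite: AroraBarak2009, §1.3] -/
theorem varOfFP : CodeFP (pairE cnfE natE) natE (fun q => varOf q.1 q.2) := litOfFP.fst'

/-- `polOf` on codes. [cite: AroraBarak2009, §1.3] -/
theorem polOfFP : CodeFP (pairE cnfE natE) bitE (fun q => polOf q.1 q.2) := litOfFP.snd'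

/-- Context of an edge test: `(φ, (a, b))`. [cite: AroraBarak2009, §1.3] -/
abbrev actxE : CNF ℕ × (ℕ × ℕ) → List Bool := pairE cnfE (pairE natE natE)

/-- `noneBetween` with the range capped at `3m` (the same value whenever it matters: `r < 3m`).
[cite: AroraBarak2009, §1.3 (polynomially bounded loops)] -/
def noneBetweenCap (φ : CNF ℕ) (r₀ r : ℕ) : Bool :=
  (List.range (min r (3 * φ.length))).all fun i => decide (i ≤ r₀) || !decide (varOf φ i = varOf φ r)

/-- The capped `R6`. [cite: AroraBarak2009, §1.3] -/
def R6cap (φ : CNF ℕ) (a b : ℕ) : Bool :=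
  isUnit φ.length a && isUnit φ.length b && decide (us φ.length a = 1) && decide (us φ.length b = 0) &&
    decide (ur φ.length a < ur φ.length b) && decide (varOf φ (ur φ.length a) = varOf φ (ur φ.length b)) &&
    noneBetweenCap φ (ur φ.length a) (ur φ.length b)

/-- The cap is invisible. [cite: AroraBarak2009, §1.3] -/
theorem R6cap_eq (φ : CNF ℕ) (a b : ℕ) : R6cap φ a b = R6 φ.length (varOf φ) a b := by
  unfold R6cap R6
  by_cases hb : isUnit φ.length b = true
  · have hr : ur φ.length b < 3 * φ.length := (eq_unitL_of_isUnit _ hb).2.1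
    unfold noneBetweenCap noneBetween
    rw [min_eq_left hr.le]
  · rw [Bool.not_eq_true] at hb
    simp [hb]

/-- **The edge test `cnfAdj` on codes.** [cite: BlaserDorflerIkenmeyer2020, Thm 22 (proof)] [cite: AroraBarak2009, §1.3] -/
theorem cnfAdjFP : CodeFP actxE bitE (fun c => cnfAdj c.1 c.2.1 c.2.2) := by
  have hφ : CodeFP actxE cnfE (fun c => c.1) := fst _ _
  have hm : CodeFP actxE natE (fun c => c.1.length) := lengthFP.comp hφ
  have hKB : CodeFP actxE natE (fun c => KB c.1.length) := (affFP 1 4 hm).congr fun _ => rfl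
  -- variable / polarity of an occurrence given on the context
  have hvar : ∀ {f : CNF ℕ × (ℕ × ℕ) → ℕ}, CodeFP actxE natE f → CodeFP actxE natE (fun c => varOf c.1 (f c)) :=
    fun hf => varOfFP.comp (hφ.pair hf)
  have hpol : ∀ {f : CNF ℕ × (ℕ × ℕ) → ℕ}, CodeFP actxE natE f → CodeFP actxE bitE (fun c => polOf c.1 (f c)) :=
    fun hf => polOfFP.comp (hφ.pair hf)
  -- the directed test for a pair of label expressions
  have hdir : ∀ {ea eb : CNF ℕ × (ℕ × ℕ) → ℕ}, CodeFP actxE natE ea → CodeFP actxE natE eb →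
      CodeFP actxE bitE (fun c => dirAdj c.1.length (varOf c.1) (polOf c.1) (ea c) (eb c)) := by
    intro ea eb ha hb
    have sA := isSlotFP hm ha; have sB := isSlotFP hm hb
    have uA := isUnitFP hm ha; have uB := isUnitFP hm hb
    have gA := isGadFP hm ha; have gB := isGadFP hm hb
    have kA := skFP (eσ := actxE) ha; have kB := skFP (eσ := actxE) hb
    have tA := stFP (eσ := actxE) ha; have tB := stFP (eσ := actxE) hb
    have rA := urFP hm ha; have rB := urFP hm hb
    have sdA := usFP hm ha; have sdB := usFP hm hb
    have jA := gjFP hm ha; have jB := gjFP hm hb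
    have yA := gtFP hm ha; have yB := gtFP hm hb
    -- R1
    have h1 : CodeFP actxE bitE (fun c => R1 c.1.length (ea c) (eb c)) :=
      (((sA.and sB).and (eqFP kA kB)).and
        ((((eqcFP 0 tA).and ((eqcFP 1 tB).or (eqcFP 2 tB))).or ((eqcFP 1 tA).and ((eqcFP 2 tB).or (eqcFP 3 tB)))).or
          ((eqcFP 2 tA).and (eqcFP 3 tB)))).congr fun _ => rfl
    -- R2
    have h2 : CodeFP actxE bitE (fun c => R2 c.1.length (ea c) (eb c)) :=
      (((((sA.and sB).and (eqFP kB (addcFP 1 kA))).and (eqFP kB hKB).not).and ((eqcFP 1 tA).or (eqcFP 2 tA))).and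
        (eqcFP 0 tB)).congr fun _ => rfl
    -- R3
    have hF0 : CodeFP actxE natE (fun c => slotL (KB c.1.length) 0) :=
      (natAdd.comp ((affFP 1 4 hKB).pair (const _ 0))).congr fun _ => rfl
    have h3 : CodeFP actxE bitE (fun c => R3 c.1.length (ea c) (eb c)) :=
      (((eqcFP 0 ha).and ((eqcFP 1 hb).or (eqFP hb hF0))).or ((eqcFP 1 ha).and (eqFP hb hF0))).congr fun _ => rfl
    -- R4
    have h4 : CodeFP actxE bitE (fun c => R4 c.1.length (ea c) (eb c)) :=
      ((((uA.and uB).and (eqFP rA rB)).and (eqcFP 0 sdA)).and (eqcFP 1 sdB)).congr fun _ => rfl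
    -- R5
    have h5 : CodeFP actxE bitE (fun c => R5 c.1.length (ea c) (eb c)) :=
      (((uA.and sB).and (eqFP kB ((natAdd.comp ((const _ 1).pair rA)).congr fun _ => rfl))).and (eqcFP 3 tB)).congr
        fun _ => rfl
    -- R6 (capped)
    have hnb : CodeFP actxE bitE (fun c => noneBetweenCap c.1 (ur c.1.length (ea c)) (ur c.1.length (eb c))) := by
      let ictx : (CNF ℕ × (ℕ × ℕ)) × ℕ → List Bool := pairE actxE natE
      have ic : CodeFP ictx actxE (fun t => t.1) := fst _ _
      have ii : CodeFP ictx natE (fun t => t.2) := snd _ _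
      have ivar : CodeFP ictx natE (fun t => varOf t.1.1 t.2) := varOfFP.comp ((hφ.comp ic).pair ii)
      have ivr : CodeFP ictx natE (fun t => varOf t.1.1 (ur t.1.1.length (eb t.1))) := (hvar rB).comp ic
      have ir₀ : CodeFP ictx natE (fun t => ur t.1.1.length (ea t.1)) := rA.comp ic
      have item : CodeFP ictx bitE (fun t => decide (t.2 ≤ ur t.1.1.length (ea t.1)) ||
          !decide (varOf t.1.1 t.2 = varOf t.1.1 (ur t.1.1.length (eb t.1)))) :=
        ((natLe.comp (ii.pair ir₀)).or (eqFP ivar ivr).not).congr fun _ => rfl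
      have hU : CodeFP actxE unE (fun c => 3 * c.1.length) := (unMulConst 3).comp (ulengthFP.comp hφ)
      have hrange : CodeFP actxE (rawE natE) (fun c => List.range (min (ur c.1.length (eb c)) (3 * c.1.length))) :=
        rangeOf.comp (hU.pair rB)
      exact ((CodeFP.all item).comp ((CodeFP.id actxE).pair hrange)).congr fun _ => rfl
    have h6 : CodeFP actxE bitE (fun c => R6 c.1.length (varOf c.1) (ea c) (eb c)) :=
      ((((((uA.and uB).and (eqcFP 1 sdA)).and (eqcFP 0 sdB)).and (ltFP rA rB)).and (eqFP (hvar rA) (hvar rB))).and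
        hnb).congr fun c => by rw [← R6cap_eq]; rfl
    -- R7
    have h7 : CodeFP actxE bitE (fun c => R7 c.1.length (ea c) (eb c)) :=
      (((gA.and gB).and (eqFP jA jB)).and
        ((((((eqcFP 0 yA).and ((eqcFP 1 yB).or (eqcFP 2 yB))).or ((eqcFP 1 yA).and (eqcFP 2 yB))).or
          ((eqcFP 2 yA).and (eqcFP 3 yB))).or ((eqcFP 3 yA).and ((eqcFP 4 yB).or (eqcFP 5 yB)))).or
          ((eqcFP 4 yA).and (eqcFP 5 yB)))).congr fun _ => rfl
    -- R8
    have hpos : CodeFP actxE natE (fun c => pos (gt c.1.length (eb c))) :=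
      ((eqcFP 4 yB).ite (const _ 2) yB).congr fun c => by unfold pos; simp only [decide_eq_true_eq]
    have htarget : CodeFP actxE natE (fun c => 3 * gj c.1.length (eb c) + pos (gt c.1.length (eb c))) :=
      (natAdd.comp ((natMul.comp ((const _ 3).pair jB)).pair hpos)).congr fun _ => rfl
    have hside : CodeFP actxE natE (fun c => if polOf c.1 (ur c.1.length (ea c)) then 0 else 1) :=
      (hpol rA).ite (const _ 0) (const _ 1)
    have h8 : CodeFP actxE bitE (fun c => R8 c.1.length (polOf c.1) (ea c) (eb c)) :=
      ((((uA.and gB).and (((eqcFP 0 yB).or (eqcFP 1 yB)).or (eqcFP 4 yB))).and (eqFP rA htarget)).and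
        (eqFP sdA hside)).congr fun _ => rfl
    -- R9
    have hkB' : CodeFP actxE natE (fun c => 1 + 3 * c.1.length + gj c.1.length (ea c)) :=
      (natAdd.comp ((affFP 1 3 hm).pair jA)).congr fun _ => rfl
    have hkF' : CodeFP actxE natE (fun c => KB c.1.length + 1 + gj c.1.length (ea c)) :=
      (natAdd.comp ((addcFP 1 hKB).pair jA)).congr fun _ => rfl
    have h9 : CodeFP actxE bitE (fun c => R9 c.1.length (ea c) (eb c)) :=
      ((((gA.and (eqcFP 5 yA)).and sB).and (eqcFP 3 tB)).and ((eqFP kB hkB').or (eqFP kB hkF'))).congr fun _ => rfl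
    exact ((((((((h1.or h2).or h3).or h4).or h5).or h6).or h7).or h8).or h9).congr fun _ => rfl
  have ha : CodeFP actxE natE (fun c => c.2.1) := (snd _ _).fst'
  have hb : CodeFP actxE natE (fun c => c.2.2) := (snd _ _).snd'
  exact ((hdir ha hb).or (hdir hb ha)).congr fun _ => rfl

/-! ### §3. The tableau of a graph given by an edge test on codes (generic) and the Karp map -/

section TableauFP

variable {σ : Type} {eσ : σ → List Bool} {N U : σ → ℕ} {E : σ → ℕ → ℕ → Bool}

/-- The cap by `d` is vacuous. [folklore] -/
private theorem singleColsCap_eq (n d : ℕ) (E' : ℕ → ℕ → Bool) : singleColsCap n d E' = singleCols n d E' := by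
  unfold singleColsCap singleCols
  congr 1
  refine List.map_congr_left fun a _ => ?_
  rw [min_eq_left (Nat.sub_le _ _)]

/-- **The tableau `T̂_G` on codes, for a graph given by an edge test computed on codes** (labels
`< N s`, `N s ≤ U s` with `U` available in unary as the loop budget).
[cite: BlaserDorflerIkenmeyer2020, Thm 22 (proof)] [cite: AroraBarak2009, §1.3 (polynomially bounded loops)] -/
theorem graphTableauFP (d : ℕ) (hN : CodeFP eσ natE N) (hU : CodeFP eσ unE U) (hNU : ∀ s, N s ≤ U s)
    (hE : CodeFP (pairE eσ (pairE natE natE)) bitE (fun c => E c.1 c.2.1 c.2.2)) :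
    CodeFP eσ tabE (fun s => graphTableau (N s) d (E s)) := by
  have hrange : CodeFP eσ (rawE natE) (fun s => List.range (N s)) :=
    (rangeOf.comp (hU.pair hN)).congr fun s => by simp [min_eq_left (hNU s)]
  have htest : CodeFP (pairE eσ (pairE natE natE)) bitE (fun c => pairTest (E c.1) c.2.1 c.2.2) :=
    ((natLt.comp ((snd _ _).fst'.pair (snd _ _).snd')).and hE).congr fun _ => rfl
  -- the two-box columns at `a`
  let ictx : (σ × ℕ) × ℕ → List Bool := pairE (pairE eσ natE) natE
  have ip : CodeFP ictx eσ (fun c => c.1.1) := (fst _ _).fst'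
  have ia : CodeFP ictx natE (fun c => c.1.2) := (fst _ _).snd'
  have ib : CodeFP ictx natE (fun c => c.2) := snd _ _
  have itest : CodeFP ictx bitE (fun c => pairTest (E c.1.1) c.1.2 c.2) := (htest.comp (ip.pair (ia.pair ib))).congr fun _ => rfl
  have itest' : CodeFP ictx bitE (fun c => pairTest (E c.1.1) c.2 c.1.2) := (htest.comp (ip.pair (ib.pair ia))).congr fun _ => rfl
  have icol : CodeFP ictx (rawE natE) (fun c => [c.1.2, c.2]) :=
    ((rawCons natE).comp (ia.pair ((rawSingleton natE).comp ib))).congr fun _ => rfl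
  have itwo : CodeFP ictx (rawE (rawE natE)) (fun c => [[c.1.2, c.2], [c.1.2, c.2]]) :=
    ((rawCons (rawE natE)).comp (icol.pair ((rawSingleton (rawE natE)).comp icol))).congr fun _ => rfl
  have iitem : CodeFP ictx (rawE (rawE natE))
      (fun c => if pairTest (E c.1.1) c.1.2 c.2 then [[c.1.2, c.2], [c.1.2, c.2]] else []) :=
    itest.ite itwo (const _ [])
  have hrange' : CodeFP (pairE eσ natE) (rawE natE) (fun q => List.range (N q.1)) := hrange.comp (fst _ _)
  have hpairAt : CodeFP (pairE eσ natE) (rawE (rawE natE)) (fun q => pairColsAt (N q.1) (E q.1) q.2) :=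
    ((flatten (rawE natE)).comp ((CodeFP.map iitem).comp ((CodeFP.id _).pair hrange'))).congr fun _ => rfl
  have hpair : CodeFP eσ (rawE (rawE natE)) (fun s => pairCols (N s) (E s)) :=
    ((flatten (rawE natE)).comp ((CodeFP.map hpairAt).comp ((CodeFP.id _).pair hrange))).congr fun _ => rfl
  -- the degree and the single boxes
  have hdeg : CodeFP (pairE eσ natE) natE (fun q => edgeDeg (N q.1) (E q.1) q.2) := by
    have h1 := (natLength natE).comp ((filter itest).comp ((CodeFP.id _).pair hrange'))
    have h2 := (natLength natE).comp ((filter itest').comp ((CodeFP.id _).pair hrange'))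
    exact (natAdd.comp (h1.pair h2)).congr fun _ => rfl
  have hcount : CodeFP (pairE eσ natE) unE (fun q => min (d - 2 * edgeDeg (N q.1) (E q.1) q.2) d) :=
    (unOfNatMin.comp ((const _ d).pair (natSub.comp ((const _ d).pair (natMul.comp ((const _ 2).pair hdeg)))))).congr
      fun _ => rfl
  have hsitem : CodeFP (pairE eσ natE) (rawE (rawE natE))
      (fun q => List.replicate (min (d - 2 * edgeDeg (N q.1) (E q.1) q.2) d) [q.2]) :=
    ((replicateOf (rawE natE)).comp (((rawSingleton natE).comp (snd _ _)).pair hcount)).congr fun _ => rfl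
  have hsingle : CodeFP eσ (rawE (rawE natE)) (fun s => singleColsCap (N s) d (E s)) :=
    ((flatten (rawE natE)).comp ((CodeFP.map hsitem).comp ((CodeFP.id _).pair hrange))).congr fun _ => rfl
  have hraw : CodeFP eσ (rawE (rawE natE)) (fun s => graphTableau (N s) d (E s)) :=
    ((rawAppend (rawE natE)).comp (hpair.pair hsingle)).congr fun s => by
      unfold graphTableau; rw [singleColsCap_eq]
  exact ((listOfRaw (listE natE)).comp ((map₀ (listOfRaw natE)).comp hraw)).congr fun s => by simp

end TableauFP

/-- The fixed no-instance: two columns of INCREASING height, never a tableau of partition shape.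
[cite: AroraBarak2009, Def. 2.7 (a fixed no-instance for non-codes)] -/
def junkTab : List (List ℕ) := [[0], [0, 0]]

/-- "every clause is nonempty and has at most three literals". [cite: GareyJohnsonStockmeyer1976, Thm 2.1 (3-CNF)] -/
def goodShape (φ : CNF ℕ) : Bool := φ.all fun c => decide (0 < c.length) && decide (c.length ≤ 3)

/-- **The instance of a CNF**: the empty CNF ↦ the yes-instance `[]`, a CNF with an empty or a wide
clause ↦ the no-instance, otherwise the BDI tableau of the graph `G_φ`. [cite: BlaserDorflerIkenmeyer2020, Thm 22 (proof)] -/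
def cnfTab (d : ℕ) (φ : CNF ℕ) : List (List ℕ) :=
  if goodShape φ then (if φ.isEmpty then [] else graphTableau (nLab φ.length) d (cnfAdj φ)) else junkTab

/-- **The Karp map on all strings**: CNF codes go to the instance of their CNF, every other string to
the no-instance. [cite: BlaserDorflerIkenmeyer2020, Thm 22 (proof)] [cite: AroraBarak2009, Def. 2.7] -/
def reduce (d : ℕ) (x : List Bool) : List (List ℕ) :=
  if encodingCNF.encode (NegCNF.decCNF x) = x then cnfTab d (NegCNF.decCNF x) else junkTab

/-- CNF codes are read in polynomial time (`KSATRed.canonCNFFn = encode ∘ decCNF`). [cite: AroraBarak2009, §1.3] -/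
theorem decCNFFP : CodeFP strE cnfE NegCNF.decCNF :=
  of_fn KSATRed.canonCNFFn KSATRed.canonCNFFn_mem_FP fun x => by rw [KSATRed.canonCNFFn_eq, cnfE_eq]; rfl

/-- The shape test on codes. [cite: AroraBarak2009, §1.3] -/
theorem goodShapeFP : CodeFP cnfE bitE goodShape := by
  have hlen : CodeFP (pairE cnfE clauseE) natE (fun q => q.2.length) := (natLength litE).comp ((rawOfList litE).comp (snd _ _))
  have hitem : CodeFP (pairE cnfE clauseE) bitE (fun q => decide (0 < q.2.length) && decide (q.2.length ≤ 3)) :=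
    ((natLt.comp ((const _ 0).pair hlen)).and (natLe.comp (hlen.pair (const _ 3)))).congr fun _ => rfl
  exact ((CodeFP.all hitem).comp ((CodeFP.id cnfE).pair (rawOfList clauseE))).congr fun _ => rfl

/-- **The instance map on CNF codes is polynomial time.** [cite: BlaserDorflerIkenmeyer2020, Thm 22 (proof)] [cite: AroraBarak2009, §1.3] -/
theorem cnfTabFP (d : ℕ) : CodeFP cnfE tabE (cnfTab d) := by
  have hN : CodeFP cnfE natE (fun φ : CNF ℕ => nLab φ.length) := (affFP 9 32 lengthFP).congr fun _ => rfl
  have hU : CodeFP cnfE unE (fun φ : CNF ℕ => 9 + 32 * φ.length) :=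
    (unAdd.comp ((const _ 9).pair ((unMulConst 32).comp ulengthFP))).congr fun _ => rfl
  have hG : CodeFP cnfE tabE (fun φ => graphTableau (nLab φ.length) d (cnfAdj φ)) :=
    graphTableauFP d hN hU (fun φ => by unfold nLab; omega) cnfAdjFP
  have hE : CodeFP cnfE bitE (fun φ : CNF ℕ => φ.isEmpty) := ((rawIsEmpty clauseE).comp (rawOfList clauseE)).congr fun _ => rfl
  exact (goodShapeFP.ite (hE.ite (const _ []) hG) (const _ junkTab)).congr fun φ => by unfold cnfTab; rfl

/-- **The Karp map `reduce d` is computed on all strings by a polynomial-time function.**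
[cite: BlaserDorflerIkenmeyer2020, Thm 22 (proof)] [cite: AroraBarak2009, §1.3, Def. 2.7] -/
theorem reduceFP (d : ℕ) : CodeFP strE tabE (reduce d) := by
  have hre : CodeFP strE strE (fun x => cnfE (NegCNF.decCNF x)) := decCNFFP
  have hinj : Function.Injective strE := fun _ _ h => h
  have htest : CodeFP strE bitE (fun x => decide (cnfE (NegCNF.decCNF x) = x)) :=
    ((eq hinj).comp (hre.pair (CodeFP.id strE))).congr fun _ => rfl
  exact (htest.ite ((cnfTabFP d).comp decCNFFP) (const _ junkTab)).congr fun x => by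
    unfold reduce; rw [cnfE_eq]; simp only [decide_eq_true_eq]

/-! ### §4. Correctness of the Karp map and the SERF reduction -/

section Correct

/-- The no-instance is not a tableau of any content. [cite: BlaserDorflerIkenmeyer2020, Def 3 (arXiv; = CCC 2021 Def 5.1: partition shape)] -/
theorem junkTab_not_mem (d M : ℕ) : junkTab ∉ nonvanishingSet₃ d M := by
  rintro ⟨n, ⟨-, hpw, -, -⟩, -, -⟩
  simp [junkTab] at hpw

/-- `numLabels junkTab = 1`. [cite: BlaserDorflerIkenmeyer2020, Def 3 (arXiv; = CCC 2021 Def 5.1)] -/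
theorem numLabels_junkTab : numLabels junkTab = 1 := by decide

/-- `numLabels [] = 1`. [cite: BlaserDorflerIkenmeyer2020, Def 3 (arXiv; = CCC 2021 Def 5.1)] -/
theorem numLabels_nil : numLabels [] = 1 := by decide

/-- The empty tableau (content `0 × d`) is a yes-instance: `f = 1`. [cite: BlaserDorflerIkenmeyer2020, eq. (5.1) (arXiv; empty product)] -/
theorem nil_mem (d M : ℕ) : ([] : List (List ℕ)) ∈ nonvanishingSet₃ d M := by
  refine ⟨0, ⟨by simp, by simp, by simp, fun u hu => by omega⟩, by simp, ?_⟩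
  unfold hwvEvalWaring placements
  simp [point₃]

/-- A CNF of good shape has nonempty clauses of width `≤ 3`. [cite: GareyJohnsonStockmeyer1976, Thm 2.1] -/
theorem goodShape_iff (φ : CNF ℕ) : goodShape φ = true ↔ (∀ c ∈ φ, c ≠ []) ∧ φ.IsWidthLE 3 := by
  unfold goodShape CNF.IsWidthLE
  simp only [List.all_eq_true, Bool.and_eq_true, decide_eq_true_eq, List.length_pos_iff]
  exact ⟨fun h => ⟨fun c hc => (h c hc).1, fun c hc => (h c hc).2⟩, fun h c hc => ⟨h.1 c hc, h.2 c hc⟩⟩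

/-- **The instance of a CNF is a yes-instance iff the CNF is a satisfiable `3`-CNF** (`d ≥ 8`, `M ≥ 2`).
[cite: BlaserDorflerIkenmeyer2020, Thm 22 (proof)] [cite: GareyJohnsonStockmeyer1976, Thm 2.1] -/
theorem cnfTab_mem_iff {d M : ℕ} (hd : 8 ≤ d) (hM : 2 ≤ M) (φ : CNF ℕ) :
    cnfTab d φ ∈ nonvanishingSet₃ d M ↔ φ.IsWidthLE 3 ∧ φ.Satisfiable := by
  unfold cnfTab
  by_cases hg : goodShape φ = true
  · rw [if_pos hg]
    obtain ⟨hne, hw⟩ := (goodShape_iff φ).1 hg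
    by_cases he : φ.isEmpty = true
    · rw [if_pos he]
      rw [List.isEmpty_iff] at he
      subst he
      exact ⟨fun _ => ⟨hw, fun _ => false, rfl⟩, fun _ => nil_mem d M⟩
    · rw [if_neg he, graphTableau_cnfAdj_mem_iff φ hne hw hd hM]
      exact ⟨fun h => ⟨hw, h⟩, fun h => h.2⟩
  · rw [if_neg hg]
    refine ⟨fun h => absurd h (junkTab_not_mem d M), fun ⟨hw, σ, hσ⟩ => absurd ?_ hg⟩
    rw [goodShape_iff]
    refine ⟨fun c hc hcn => ?_, hw⟩
    subst hcn
    unfold CNF.eval at hσ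
    rw [List.all_eq_true] at hσ
    simpa using hσ [] hc

/-- **The number of labels of the instance is linear in the number of clauses**: `numLabels - 1 ≤ 40 m`.
[cite: ImpagliazzoPaturiZaneJCSS2001, §2.1 (SERF: parameter of the query linear in the parameter)] -/
theorem numLabels_cnfTab_le (d : ℕ) (hd : 8 ≤ d) (φ : CNF ℕ) : numLabels (cnfTab d φ) - 1 ≤ 40 * φ.length := by
  unfold cnfTab
  split_ifs with hg he
  · rw [numLabels_nil]; omega
  · have h := numLabels_graphTableau_cnfAdj_le φ hd
    have hm : 0 < φ.length := by
      rw [Bool.not_eq_true, List.isEmpty_eq_false_iff, ← List.length_pos_iff] at he; exact he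
    have h2 : nLab φ.length = 9 + 32 * φ.length := rfl
    omega
  · rw [numLabels_junkTab]; omega

/-- **Correctness of the Karp map**: `x ∈ 3SAT ⟺ reduce d x` is a yes-instance. [cite: BlaserDorflerIkenmeyer2020, Thm 22 (proof)] -/
theorem mem_kSAT_iff_reduce_mem {d M : ℕ} (hd : 8 ≤ d) (hM : 2 ≤ M) (x : List Bool) :
    x ∈ kSAT 3 ↔ reduce d x ∈ nonvanishingSet₃ d M := by
  unfold reduce
  by_cases hx : encodingCNF.encode (NegCNF.decCNF x) = x
  · rw [if_pos hx, cnfTab_mem_iff hd hM]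
    conv_lhs => rw [← hx]
    unfold kSAT
    rw [Encoding.mem_toLanguage_iff]
    rfl
  · rw [if_neg hx]
    exact ⟨fun h => absurd (KSATRed.encode_decCNF_of_mem h) hx, fun h => absurd h (junkTab_not_mem d M)⟩

/-- The parameter of the query is linear in the parameter of the instance.
[cite: ImpagliazzoPaturiZaneJCSS2001, §2.1 (SERF)] -/
theorem param_reduce_le {d : ℕ} (hd : 8 ≤ d) (M : ℕ) (x : List Bool) :
    (subexpParam (nonvanishingSet₃ d M) id).param (tableauEncoding.encode (reduce d x)) ≤
      40 * (kSATClauseParam 3).param x := by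
  rw [subexpParam_param_encode]
  unfold reduce
  by_cases hx : encodingCNF.encode (NegCNF.decCNF x) = x
  · rw [if_pos hx]
    conv_rhs => rw [← hx, kSATClauseParam_param_encode]
    exact numLabels_cnfTab_le d hd _
  · rw [if_neg hx, numLabels_junkTab]; simp

end Correct

section SERF

open Literature.Computability.FineGrained (exists_eval_le_mul_succ_pow mul_succ_pow_mono)

/-- **`3`-SAT with parameter `m` SERF-reduces to BDI's nonvanishing problem with parameter
`numLabels - 1`** (one query: the Karp map `reduce d`, packaged as in Ladner–Lynch–Selman; the
parameter of the query is `≤ 40 m`, its length polynomial).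
[cite: ImpagliazzoPaturiZaneJCSS2001, §2.1 (SERF reductions)] [cite: BlaserDorflerIkenmeyer2020, Thm 22 (arXiv; = CCC 2021 Thm 8.1)] -/
theorem serfReducible_kSAT_subexpParam {d M : ℕ} (hd : 8 ≤ d) (hM : 2 ≤ M) :
    SERFReducible (kSATClauseParam 3) (subexpParam (nonvanishingSet₃ d M) id) := by
  intro ε hε
  obtain ⟨f, hf, hfeq⟩ := reduceFP d
  have hfx : ∀ x, f x = tableauEncoding.encode (reduce d x) := fun x => by rw [tabE_eq]; exact hfeq x
  obtain ⟨p, Mr, hMr⟩ := hf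
  obtain ⟨s, hs⟩ := exists_poly_length_le_of_mem_FP (show f ∈ FP from ⟨p, Mr, hMr⟩)
  obtain ⟨C₁, hC₁, hp⟩ := exists_eval_le_mul_succ_pow p
  obtain ⟨C₂, hC₂, hsC⟩ := exists_eval_le_mul_succ_pow s
  let Tstep : List Bool × List (List Bool) → ℕ := fun q =>
    p.eval q.1.length + (2 * q.1.length + 4) + (boolPair q.1 ((encodingList Bool).listBool.encode q.2)).length
  have hT : ∀ (x : List Bool) (as : List (List Bool)),
      Tstep (x, as) ≤ (C₁ + 6) * (x.length + 1) ^ (C₁ + 6) * (((encodingList Bool).listBool.encode as).length + 1) := by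
    intro x as
    have h1 : p.eval x.length + 4 * x.length + 6 ≤ (C₁ + 6) * (x.length + 1) ^ (C₁ + 6) := by
      have e1 := hp x.length
      have e2 : (x.length + 1) ≤ (x.length + 1) ^ C₁ := by
        simpa using Nat.pow_le_pow_right (Nat.succ_pos x.length) hC₁
      have e3 := mul_succ_pow_mono (show C₁ ≤ C₁ + 6 by omega) x.length
      have e4 : (x.length + 1) ^ C₁ ≤ (x.length + 1) ^ (C₁ + 6) := Nat.pow_le_pow_right (Nat.succ_pos _) (by omega)
      nlinarith
    have h2 : 1 ≤ (C₁ + 6) * (x.length + 1) ^ (C₁ + 6) := Nat.one_le_iff_ne_zero.2 (by positivity)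
    have h3 : Tstep (x, as) = p.eval x.length + 4 * x.length + 6 + ((encodingList Bool).listBool.encode as).length := by
      simp only [Tstep, length_boolPair]; omega
    rw [h3]
    nlinarith
  refine ⟨karpAlg f, fun _ => 2, Tstep, max 40 (2 * C₂), ⟨2, fun x => ?_⟩, ⟨karpLift Mr, ?_⟩, ⟨C₁ + 6, fun x as => ?_⟩,
    fun x => ?_, fun x q hq => ?_⟩
  · -- the round budget `2` is subexponential
    have h2 : (1 : ℝ) ≤ (2 : ℝ) ^ (ε * ((kSATClauseParam 3).param x : ℝ)) := Real.one_le_rpow one_le_two (by positivity)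
    have h3 : (1 : ℝ) ≤ ((x.length : ℝ) + 1) ^ (2 : ℕ) := one_le_pow₀ (by linarith [Nat.cast_nonneg (α := ℝ) x.length])
    calc (((fun _ : List Bool => (2 : ℕ)) x : ℕ) : ℝ) = 2 * 1 * 1 := by norm_num
      _ ≤ (2 : ℕ) * (2 : ℝ) ^ (ε * ((kSATClauseParam 3).param x : ℝ)) * ((x.length : ℝ) + 1) ^ (2 : ℕ) := by
        push_cast; gcongr
  · -- the step machine
    rintro ⟨x, _ | ⟨a, as⟩⟩
    · change (karpLift Mr).OutputsWithin (boolPair x ((encodingList Bool).listBool.encode [])) (false :: f x) (Tstep (x, []))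
      rw [listBool_encode_nil]
      refine (outputsWithin_karpLift_query Mr (hMr x)).mono ?_
      simp only [Tstep, id, listBool_encode_nil]
      omega
    · change (karpLift Mr).OutputsWithin (boolPair x ((encodingList Bool).listBool.encode (a :: as)))
        [true, a.headD false] (Tstep (x, a :: as))
      refine (outputsWithin_karpLift_answer Mr x a as).mono ?_
      simp only [Tstep]
      omega
  · -- the step time is within the SERF bound
    have h1 : (Tstep (x, as) : ℝ) ≤ ((C₁ + 6 : ℕ) : ℝ) * ((x.length : ℝ) + 1) ^ (C₁ + 6) *
        ((((encodingList Bool).listBool.encode as).length : ℝ) + 1) := by exact_mod_cast hT x as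
    refine h1.trans ?_
    have h2 : (1 : ℝ) ≤ (2 : ℝ) ^ (ε * ((kSATClauseParam 3).param x : ℝ)) := Real.one_le_rpow one_le_two (by positivity)
    calc ((C₁ + 6 : ℕ) : ℝ) * ((x.length : ℝ) + 1) ^ (C₁ + 6) * ((((encodingList Bool).listBool.encode as).length : ℝ) + 1)
        = ((C₁ + 6 : ℕ) : ℝ) * 1 * ((x.length : ℝ) + 1) ^ (C₁ + 6) *
          ((((encodingList Bool).listBool.encode as).length : ℝ) + 1) := by ring
      _ ≤ ((C₁ + 6 : ℕ) : ℝ) * (2 : ℝ) ^ (ε * ((kSATClauseParam 3).param x : ℝ)) * ((x.length : ℝ) + 1) ^ (C₁ + 6) *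
          ((((encodingList Bool).listBool.encode as).length : ℝ) + 1) := by gcongr
  · -- the run: one query, the oracle's answer bit is the answer
    have hrun : (karpAlg f).run (Oracle.ofLanguage (subexpParam (nonvanishingSet₃ d M) id).lang) 2 x =
        some (((Oracle.ofLanguage (subexpParam (nonvanishingSet₃ d M) id).lang) (f x)).headD false) :=
      run_karpAlg f _ 0 x
    rw [hrun, Oracle.ofLanguage_apply, subexpParam_lang, kSATClauseParam_lang]
    simp only [encodeBool, Option.some.injEq]
    have hiff : x ∈ kSAT 3 ↔ f x ∈ tableauEncoding.toLanguage (nonvanishingSet₃ d M) := by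
      rw [hfx, Encoding.mem_toLanguage_iff]; exact mem_kSAT_iff_reduce_mem hd hM x
    rcases Bool.eq_false_or_eq_true ((kSAT 3).boolIndicator x) with h1 | h1
    · rw [h1]
      exact (Set.mem_iff_boolIndicator _ _).1 (hiff.1 ((Set.mem_iff_boolIndicator _ _).2 h1))
    · rw [h1]
      exact (Set.notMem_iff_boolIndicator _ _).1 fun h => (Set.notMem_iff_boolIndicator _ _).2 h1 (hiff.2 h)
  · -- the query: parameter `≤ 40 m`, length polynomial
    have hq' : q = f x := by
      have hqs : (karpAlg f).queries (Oracle.ofLanguage (subexpParam (nonvanishingSet₃ d M) id).lang) 2 x = [f x] :=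
        queries_karpAlg f _ 0 x
      rw [hqs, List.mem_singleton] at hq
      exact hq
    subst hq'
    refine ⟨?_, ?_⟩
    · rw [hfx]
      exact (param_reduce_le hd M x).trans (Nat.mul_le_mul_right _ (le_max_left _ _))
    · refine (hs x).trans ((hsC x.length).trans ?_)
      refine le_trans ?_ (mul_succ_pow_mono (le_max_right 40 (2 * C₂)) x.length)
      exact (Nat.mul_le_mul_left _ (Nat.pow_le_pow_right (Nat.succ_pos _) (by omega))).trans
        (Nat.mul_le_mul_right _ (by omega))

end SERF

end BDI20ETH

/-! ### §5. Discharge of `BDI2020_thm_8_1_eth` -/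

section Discharge

open Literature.Computability.Complexity Literature.Computability.Cryptography Literature.Computability.FineGrained
open BDI2020

/-- **Discharge of `BDI2020_thm_8_1_eth`** (BDI CCC 2021 Thm 8.1 = arXiv Thm 22, ETH clause: "Assuming
ETH no `2^{o(n)}` algorithm for this evaluation can exist", for `d ≥ 8`, `m ≥ 2`). Under ETH, `3`-SAT
with parameter `m` is not in `SE` (`eth_iff_kSATClauseParam_not_mem_SE_holds`, Impagliazzo–Paturi–Zane
Cor. 2 over the proved sparsification lemma); a `2^{o(n)}` decider for the nonvanishing problem would
put `subexpParam (nonvanishingSet₃ d m) id` in `SE` (`subexpParam_mem_SE`), hence, along the SERF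
reduction `BDI20ETH.serfReducible_kSAT_subexpParam` (the printed Karp map on the linear-size
maximum-degree-`4` graph of `BDI20BoundedDegreeSatGraph.lean`) and the closure of `SE` under SERF
reductions (`mem_SE_of_serfReducible_holds`), also `3`-SAT with parameter `m` — a contradiction.
[cite: BlaserDorflerIkenmeyer2020, Thm 22 (arXiv p0017.txt:L21; = CCC 2021 Thm 8.1)] -/
theorem BDI2020_thm_8_1_eth_holds : BDI2020_thm_8_1_eth := by
  intro hETH d M hd hM hdec
  have hSE : subexpParam (nonvanishingSet₃ d M) id ∈ SE :=
    subexpParam_mem_SE (T₀ := BDI20ETH.junkTab) (BDI20ETH.junkTab_not_mem d M) hdec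
  exact (eth_iff_kSATClauseParam_not_mem_SE_holds.1 hETH)
    (mem_SE_of_serfReducible_holds (BDI20ETH.serfReducible_kSAT_subexpParam hd hM) hSE)

end Discharge

end Literature.Computability.AlgebraicComplexity

end
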